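import Summits.ResolutionOfSingularities.ResolutionOfSingularities.Theorems.HilbertSamuelEliminationSigmaMaxModificationsCorridor3HypersurfaceHilbertFunction
import Literature.AlgebraicGeometry.Resolution.CohenMacaulayCatenary
import Literature.AlgebraicGeometry.Resolution.DimensionFormula
import Literature.AlgebraicGeometry.Resolution.HilbertSamuelLocal
import Mathlib.RingTheory.Ideal.KrullsHeightTheorem
import HarnessLib

/-!
# Route `HilbertSamuelElimination`, crux `SigmaMaxModificationsCorridor3`
# (stmt-ResolutionOfSingularities-19249; child of `SigmaMaxModifications` stmt-…-18506),
# line `tame_wild`: the Hilbert–Samuel function of a HYPERSURFACE POINT at every level, and what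
# the maximality of a tame value says about multiplicities (input of H5)

[OURS · L1 W4.2] Bookkeeping for step (1)/(5) of `stub_tameNu3` (`L/w42/CRUX-PLAN.md` v1 §2, H5 in
the lead's `TameArchitecture.lean`: "`supp(𝓘_Y, m) = Y(ν)` locally", "`ord_x 𝓘 ≤ m` everywhere"),
the converse direction to H1/H1″ (`…Corridor3TameValueHypersurface.lean`,
`…Corridor3HypersurfaceValues.lean`) assembled from stub-1's H1′
(`…Corridor3HypersurfaceHilbertFunction.lean`). NOT a statement of any manuscript.

* `hypersurfaceHFe_mono_right`, `hypersurfaceHFe_apply_self_lt`, `hypersurfaceHFe_le_iff`,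
  `hypersurfaceHFe_injective` — the hypersurface Hilbert functions `hypersurfaceHFe e m` are
  monotone and (for `e ≥ 1`) order-EMBEDDING in the multiplicity `m`: multiplicities compare as
  their Hilbert functions do.
* `minimalPrimesCodim_quotient_span_singleton` — **`ψ(R/(g)) = dim R - 1`** for a regular local
  ring `R` and `0 ≠ g ∈ 𝔪` (the minimal primes over `(g)` have height one, Krull; dimension
  formula in the catenary domain `R`, Matsumura §5 / Thm. 17.4): a hypersurface is
  equidimensional, so Bennett's shift `φ = N - ψ` at a hypersurface point is `N + 1 - dim R`.
* `hsPsi_eq_of_stalk_ringEquiv`, `hilbertFun_stalk_eq_of_stalk_ringEquiv`,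
  **`hsFun_eq_hypersurfaceHFe_of_stalk_ringEquiv`** — if `𝒪_{Y,y} ≅ R/(g)` with `R` regular local
  of dimension `e ≤ N + 1` and `g ∈ 𝔪^m ∖ 𝔪^{m+1}` (`m ≥ 1`), then `ψ_Y(y) = e - 1`,
  `H^{(0)}(𝒪_{Y,y}) = hypersurfaceHFe e m` and **`H^N_Y(y) = hypersurfaceHFe (N+1) m`** (CJS
  Def. 2.28; at `N = 3`: `= hypersurfaceHF m`) — Bennett: the Hilbert–Samuel function of a
  hypersurface point of multiplicity `m` at any level.
* **`mult_le_of_maximal_hypersurfaceHFe`**, **`mem_hsStratum_iff_mult_eq_of_maximal`** — if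
  `ν = hypersurfaceHFe (N+1) m` is a MAXIMAL value of `Σ_Y(N)`, every hypersurface point of `Y`
  (in the above sense) has multiplicity `≤ m`, with equality iff it lies in the stratum `Y(ν)`:
  the Hilbert–Samuel form of "`ord 𝓘_Y ≤ m` near `Y(ν)` and `supp(𝓘_Y, m) = Y(ν)`".

## Sources

* V. Cossart, U. Jannsen, S. Saito, LNM 2270 (2020): Def. 2.28, Thm. 2.3, Lemma 2.23, §2.2.
  [CossartJannsenSaito2020]
* H. Matsumura, *Commutative Ring Theory* (1986), §5 (dimension formula), Thm. 17.4.
  [Matsumura1987]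
-/

set_option linter.dupNamespace false -- mandated namespace of this single-conjunct summit

noncomputable section

open IsLocalRing AlgebraicGeometry
open Literature.RingTheory.HilbertSamuel Literature.AlgebraicGeometry.Resolution
open Summit.ResolutionOfSingularities.ResolutionOfSingularities.Theorems.SigmaMaxModificationsCorridor3.TameWild

namespace Summit.ResolutionOfSingularities.ResolutionOfSingularities.Theorems.SigmaMaxModificationsCorridor3.Helpers

universe u v

/-! ## The hypersurface Hilbert functions are order-embedding in the multiplicity -/

/-- `m ≤ m' ⇒ hypersurfaceHFe e m ≤ hypersurfaceHFe e m'` (fewer multiples are subtracted).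
[cite: CossartJannsenSaito2020, Thm. 2.3] -/
theorem hypersurfaceHFe_mono_right (e : ℕ) {m m' : ℕ} (h : m ≤ m') :
    hypersurfaceHFe e m ≤ hypersurfaceHFe e m' := by
  intro n
  rw [hypersurfaceHFe_apply, hypersurfaceHFe_apply]
  by_cases h1 : m' ≤ n
  · rw [if_pos h1, if_pos (h.trans h1)]
    have hc : (n - m' + e - 1).choose (e - 1) ≤ (n - m + e - 1).choose (e - 1) :=
      Nat.choose_le_choose _ (by omega)
    exact Nat.sub_le_sub_left hc _
  · rw [if_neg h1, Nat.sub_zero]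
    exact Nat.sub_le _ _

/-- At the argument `n = m` the functions of multiplicities `m < m'` differ (`e ≥ 1`):
`hypersurfaceHFe e m m = Φ^{(e)}(m) - 1 < Φ^{(e)}(m) = hypersurfaceHFe e m' m`.
[cite: CossartJannsenSaito2020, Thm. 2.3] -/
theorem hypersurfaceHFe_apply_self_lt {e m m' : ℕ} (he : 1 ≤ e) (h : m < m') :
    hypersurfaceHFe e m m < hypersurfaceHFe e m' m := by
  rw [hypersurfaceHFe_apply, hypersurfaceHFe_apply, if_pos le_rfl, if_neg (by omega), Nat.sub_self,
    show 0 + e - 1 = e - 1 by omega, Nat.choose_self, Nat.sub_zero]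
  have hpos : 0 < (m + e - 1).choose (e - 1) := Nat.choose_pos (by omega)
  omega

/-- **`hypersurfaceHFe e m ≤ hypersurfaceHFe e m' ↔ m ≤ m'`** for `e ≥ 1`: multiplicities compare
as their Hilbert functions do. [cite: CossartJannsenSaito2020, Thm. 2.3] -/
theorem hypersurfaceHFe_le_iff {e m m' : ℕ} (he : 1 ≤ e) :
    hypersurfaceHFe e m ≤ hypersurfaceHFe e m' ↔ m ≤ m' := by
  refine ⟨fun h => ?_, hypersurfaceHFe_mono_right e⟩
  by_contra hlt
  exact absurd (h m') (not_le.mpr (hypersurfaceHFe_apply_self_lt he (not_le.mp hlt)))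

/-- `m ↦ hypersurfaceHFe e m` is injective for `e ≥ 1`. [cite: CossartJannsenSaito2020, Thm. 2.3] -/
theorem hypersurfaceHFe_injective {e : ℕ} (he : 1 ≤ e) : Function.Injective (hypersurfaceHFe e) :=
  fun _ _ h => le_antisymm ((hypersurfaceHFe_le_iff he).mp h.le) ((hypersurfaceHFe_le_iff he).mp h.ge)

/-! ## `ψ` of a hypersurface ring -/

/-- **`ψ(R/(g)) = dim R - 1`** for a regular local ring `R` of dimension `e` and `0 ≠ g ∈ 𝔪`:
every minimal prime `𝔭` over `(g)` has height exactly `1` (Krull's principal ideal theorem, and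
`𝔭 ≠ 0` in the domain `R`), so `dim R/𝔭 = e - 1` by the dimension formula in the catenary local
domain `R`. [cite: Matsumura1987, §5 (p. 31), Thm. 17.4] -/
theorem minimalPrimesCodim_quotient_span_singleton {R : Type u} [CommRing R] [IsRegularLocalRing R]
    {e : ℕ} (he : ringKrullDim R = e) {g : R} (hg : g ∈ maximalIdeal R) (hg0 : g ≠ 0) :
    minimalPrimesCodim (R ⧸ Ideal.span {g}) = e - 1 := by
  haveI : IsDomain R := isDomain_of_isRegularLocalRing R
  haveI : Nontrivial (R ⧸ Ideal.span {g}) :=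
    Ideal.Quotient.nontrivial_iff.mpr (by rw [Ne, Ideal.span_singleton_eq_top]; exact hg)
  haveI : IsLocalRing (R ⧸ Ideal.span {g}) :=
    .of_surjective' (Ideal.Quotient.mk _) Ideal.Quotient.mk_surjective
  obtain ⟨P', hP', hdim⟩ :=
    exists_minimalPrimes_ringKrullDim_eq_minimalPrimesCodim (R ⧸ Ideal.span {g})
  -- `P = P' ∩ R` is a minimal prime over `(g)`, of height `1`
  set P : Ideal R := P'.comap (Ideal.Quotient.mk (Ideal.span {g})) with hP
  have hPmin : P ∈ (Ideal.span {g}).minimalPrimes := by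
    rw [Ideal.minimalPrimes_eq_comap]
    exact ⟨P', hP', rfl⟩
  haveI hPp : P.IsPrime := hPmin.1.1
  have hgP : g ∈ P := hPmin.1.2 (Ideal.mem_span_singleton_self g)
  have h1 : P.height = 1 := by
    refine le_antisymm
      (Ideal.height_le_one_of_isPrincipal_of_mem_minimalPrimes (Ideal.span {g}) P hPmin) ?_
    rw [Order.one_le_iff_ne_zero, Ne, Ideal.height_eq_zero_iff_eq_bot]
    intro hbot
    rw [hbot, Ideal.mem_bot] at hgP
    exact hg0 hgP
  -- dimension formula `ht 𝔪 = ht P + ht (𝔪/P)` in the catenary domain `R`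
  have hcat := (isCatenaryRing_of_isRegularLocalRing R).height_eq_height_add_height_map_quotientMk
    (IsLocalRing.le_maximalIdeal hPp.ne_top)
  haveI : Nontrivial (R ⧸ P) := Ideal.Quotient.nontrivial_iff.mpr hPp.ne_top
  haveI : IsLocalRing (R ⧸ P) := .of_surjective' (Ideal.Quotient.mk P) Ideal.Quotient.mk_surjective
  obtain ⟨d', hd'⟩ := exists_nat_cast_eq_ringKrullDim (R := R ⧸ P)
  have hmR : (maximalIdeal R).height = e := by
    have h := IsLocalRing.maximalIdeal_height_eq_ringKrullDim (R := R)
    rw [he] at h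
    exact_mod_cast h
  have hmR' : (maximalIdeal (R ⧸ P)).height = d' := by
    have h := IsLocalRing.maximalIdeal_height_eq_ringKrullDim (R := R ⧸ P)
    rw [hd'] at h
    exact_mod_cast h
  rw [IsLocalRing.map_maximalIdeal_of_surjective _ Ideal.Quotient.mk_surjective, hmR, hmR', h1]
    at hcat
  have hsum : e = 1 + d' := by exact_mod_cast hcat
  -- `(R/(g))/P' ≅ R/P`
  have hP'eq : P.map (Ideal.Quotient.mk (Ideal.span {g})) = P' :=
    Ideal.map_comap_of_surjective _ Ideal.Quotient.mk_surjective P'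
  have hle : Ideal.span {g} ≤ P := (Ideal.span_singleton_le_iff_mem _).mpr hgP
  let ε : (R ⧸ Ideal.span {g}) ⧸ P' ≃+* R ⧸ P :=
    (Ideal.quotEquivOfEq hP'eq.symm).trans (DoubleQuot.quotQuotEquivQuotOfLE hle)
  rw [ringKrullDim_eq_of_ringEquiv ε, hd'] at hdim
  have hd'' : d' = minimalPrimesCodim (R ⧸ Ideal.span {g}) := by exact_mod_cast hdim
  omega

/-! ## The Hilbert–Samuel function of a hypersurface point -/

section Stalk

variable {Y : Scheme.{u}} {y : Y} {R : Type v} [CommRing R] [IsRegularLocalRing R] {e m : ℕ}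

/-- If `𝒪_{Y,y} ≅ R/(g)`, `R` regular local of dimension `e`, `0 ≠ g ∈ 𝔪`, then
`ψ_Y(y) = e - 1`. [cite: CossartJannsenSaito2020, Def. 2.28 (2)] -/
theorem hsPsi_eq_of_stalk_ringEquiv (he : ringKrullDim R = e) {g : R} (hg : g ∈ maximalIdeal R)
    (hg0 : g ≠ 0) (ε : Y.presheaf.stalk y ≃+* R ⧸ Ideal.span {g}) :
    Scheme.hsPsi Y y = e - 1 := by
  rw [Scheme.hsPsi, minimalPrimesCodim_eq_of_ringEquiv ε,
    minimalPrimesCodim_quotient_span_singleton he hg hg0]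

/-- If `𝒪_{Y,y} ≅ R/(g)`, `R` regular local of dimension `e`, `g ∈ 𝔪^m ∖ 𝔪^{m+1}`, then
`H^{(0)}(𝒪_{Y,y}) = hypersurfaceHFe e m` (H1′). [cite: CossartJannsenSaito2020, Thm. 2.3, §2.2 (p. 27)] -/
theorem hilbertFun_stalk_eq_of_stalk_ringEquiv (he : ringKrullDim R = e) {g : R}
    (hgm : g ∈ maximalIdeal R ^ m) (hgm' : g ∉ maximalIdeal R ^ (m + 1))
    (ε : Y.presheaf.stalk y ≃+* R ⧸ Ideal.span {g}) :
    hilbertFun (Y.presheaf.stalk y) = hypersurfaceHFe e m := by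
  haveI : IsLocalRing (R ⧸ Ideal.span {g}) := ε.isLocalRing
  rw [← hilbertFun_eq_of_ringEquiv ε.symm, stub_H1_hilbertFun_quotient_span_singleton he hgm hgm']

/-- **Bennett: the Hilbert–Samuel function of a hypersurface point of multiplicity `m` is
`hypersurfaceHFe (N+1) m` at every level `N ≥ dim R - 1`.** If `𝒪_{Y,y} ≅ R/(g)` with `R`
regular local of dimension `e ≤ N + 1` and `g ∈ 𝔪^m ∖ 𝔪^{m+1}`, `m ≥ 1`, then
`H^N_Y(y) = hypersurfaceHFe (N+1) m` (`ψ_Y(y) = e - 1`, `H^{(0)} = hypersurfaceHFe e m`, and one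
partial summation raises `e` by one). [cite: CossartJannsenSaito2020, Def. 2.28, Thm. 2.3] -/
theorem hsFun_eq_hypersurfaceHFe_of_stalk_ringEquiv {N : ℕ} (he : ringKrullDim R = e)
    (heN : e ≤ N + 1) (hm : 1 ≤ m) {g : R} (hgm : g ∈ maximalIdeal R ^ m)
    (hgm' : g ∉ maximalIdeal R ^ (m + 1)) (ε : Y.presheaf.stalk y ≃+* R ⧸ Ideal.span {g}) :
    Scheme.hsFun Y N y = hypersurfaceHFe (N + 1) m := by
  have hg : g ∈ maximalIdeal R := Ideal.pow_le_self (Nat.pos_iff_ne_zero.mp hm) hgm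
  have hg0 : g ≠ 0 := fun h => hgm' (h ▸ zero_mem _)
  -- `e ≥ 1`: `R` is not a field since `0 ≠ g ∈ 𝔪`
  have he1 : 1 ≤ e := by
    by_contra h0
    have hd : (maximalIdeal R).spanFinrank = 0 := by
      have h := IsRegularLocalRing.spanFinrank_maximalIdeal (R := R)
      rw [he] at h
      have h' : (maximalIdeal R).spanFinrank = e := by exact_mod_cast h
      omega
    have hbot : maximalIdeal R = ⊥ :=
      (Submodule.spanFinrank_eq_zero_iff_eq_bot (IsNoetherian.noetherian (maximalIdeal R))).mp hd
    rw [hbot, Ideal.mem_bot] at hg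
    exact hg0 hg
  have hψ : Scheme.hsPsi Y y = e - 1 := hsPsi_eq_of_stalk_ringEquiv he hg hg0 ε
  refine hsFun_eq_hypersurfaceHFe_of_hilbertFun_eq (by omega) ?_
  rw [hψ, show e - 1 + 1 = e by omega]
  exact hilbertFun_stalk_eq_of_stalk_ringEquiv he hgm hgm' ε

end Stalk

/-! ## Maximality of a tame value bounds the multiplicities -/

section Maximal

variable {Y : Scheme.{u}} {N m : ℕ}

/-- **A maximal hypersurface value bounds the multiplicities.** If
`ν = hypersurfaceHFe (N+1) m` is maximal in `Σ_Y(N)` and `H^N_Y(y) = hypersurfaceHFe (N+1) m'`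
(e.g. `y` a hypersurface point of multiplicity `m'`, `hsFun_eq_hypersurfaceHFe_of_stalk_ringEquiv`),
then `m' ≤ m` (otherwise `ν < H^N_Y(y) ∈ Σ_Y(N)`).
[cite: CossartJannsenSaito2020, Def. 2.35, Thm. 2.3] -/
theorem mult_le_of_maximal_hypersurfaceHFe (hν : Maximal (· ∈ Scheme.hsValues Y N) (hypersurfaceHFe (N + 1) m))
    {y : Y} {m' : ℕ} (hy : Scheme.hsFun Y N y = hypersurfaceHFe (N + 1) m') : m' ≤ m := by
  by_contra hlt
  have hle : hypersurfaceHFe (N + 1) m ≤ hypersurfaceHFe (N + 1) m' :=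
    hypersurfaceHFe_mono_right _ (le_of_lt (not_le.mp hlt))
  have hmem : hypersurfaceHFe (N + 1) m' ∈ Scheme.hsValues Y N := ⟨y, hy⟩
  have hge := hν.2 hmem hle
  exact hlt ((hypersurfaceHFe_le_iff (Nat.succ_pos N)).mp hge)

/-- **The stratum of a maximal hypersurface value is the locus of maximal multiplicity.** Under
the same hypotheses, `y ∈ Y(ν) ↔ m' = m`. [cite: CossartJannsenSaito2020, Def. 2.28 (4), Def. 2.35] -/
theorem mem_hsStratum_iff_mult_eq_of_hsFun_eq {y : Y} {m' : ℕ}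
    (hy : Scheme.hsFun Y N y = hypersurfaceHFe (N + 1) m') :
    y ∈ Scheme.hsStratum Y N (hypersurfaceHFe (N + 1) m) ↔ m' = m := by
  rw [Scheme.mem_hsStratum_iff, hy]
  exact ⟨fun h => hypersurfaceHFe_injective (Nat.succ_pos N) h, fun h => by rw [h]⟩

/-- **Hypersurface points off the stratum of a maximal hypersurface value have SMALLER
multiplicity**: `y ∉ Y(ν) ⇒ m' < m`. [cite: CossartJannsenSaito2020, Def. 2.35, Thm. 2.3] -/
theorem mult_lt_of_not_mem_hsStratum_of_maximal
    (hν : Maximal (· ∈ Scheme.hsValues Y N) (hypersurfaceHFe (N + 1) m)) {y : Y} {m' : ℕ}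
    (hy : Scheme.hsFun Y N y = hypersurfaceHFe (N + 1) m')
    (hys : y ∉ Scheme.hsStratum Y N (hypersurfaceHFe (N + 1) m)) : m' < m :=
  lt_of_le_of_ne (mult_le_of_maximal_hypersurfaceHFe hν hy)
    (fun h => hys ((mem_hsStratum_iff_mult_eq_of_hsFun_eq hy).mpr h))

/-- **Packaged for the tame line.** `ν = hypersurfaceHFe (N+1) m` maximal in `Σ_Y(N)`; `y` a point
with `𝒪_{Y,y} ≅ R/(g)`, `R` regular local of dimension `e ≤ N + 1`, `g ∈ 𝔪^{m'} ∖ 𝔪^{m'+1}`,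
`m' ≥ 1`. Then `m' ≤ m`, and `y ∈ Y(ν) ↔ m' = m` — at level `N = 3` with `ν = hypersurfaceHF m`
tame: the multiplicity of the local equation of `Y` is `≤ m` at every hypersurface point and `= m`
exactly on the stratum. [cite: CossartJannsenSaito2020, Def. 2.28, Def. 2.35, Thm. 2.3] -/
theorem mult_le_and_mem_hsStratum_iff_of_stalk_ringEquiv
    (hν : Maximal (· ∈ Scheme.hsValues Y N) (hypersurfaceHFe (N + 1) m)) {y : Y}
    {R : Type v} [CommRing R] [IsRegularLocalRing R] {e m' : ℕ} (he : ringKrullDim R = e)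
    (heN : e ≤ N + 1) (hm' : 1 ≤ m') {g : R} (hgm : g ∈ maximalIdeal R ^ m')
    (hgm' : g ∉ maximalIdeal R ^ (m' + 1)) (ε : Y.presheaf.stalk y ≃+* R ⧸ Ideal.span {g}) :
    m' ≤ m ∧ (y ∈ Scheme.hsStratum Y N (hypersurfaceHFe (N + 1) m) ↔ m' = m) :=
  have hy := hsFun_eq_hypersurfaceHFe_of_stalk_ringEquiv he heN hm' hgm hgm' ε
  ⟨mult_le_of_maximal_hypersurfaceHFe hν hy, mem_hsStratum_iff_mult_eq_of_hsFun_eq hy⟩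

end Maximal

end Summit.ResolutionOfSingularities.ResolutionOfSingularities.Theorems.SigmaMaxModificationsCorridor3.Helpers

end
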